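import Summits.Ventures.QEC.Census.CertInfoSet
import Summits.Ventures.QEC.Census.CertCheck
import HarnessLib

/-!
# Information-set lower-bound certificates for CSS distance, II: soundness (PARTITION v2.2 item 07.IS)
What the words of `Census/CertInfoSet.lean` establish (label-free case of CERT-FORMAT v1 §5.3 / L5), against
type-10's `Census/CertCheck.lean` and type-02's `CSSCode.dZ_eq_of_witness`: unit pivot columns and row-space
membership of the reduced rows; free coordinates of the kernel-basis words and `⟨ρ_i, γ_j⟩ = 0`; UNIQUENESS
(`eq_zero_of_free_zero_of_orth`); DECOMPOSITION (`eq_ofBits_freeSupp`: a kernel vector is the XOR of the basis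
words of its free support); **`infoSet_lower_sound`**; assembly `DistCert.dZ_code_of_infoSet` / `dX_code_of_infoSet`.
All proved; axioms ⊆ {propext, Classical.choice, Quot.sound}.
-/

namespace Summit.Ventures.QEC.Census

open Matrix Literature.InformationTheory.QuantumCodes

section Sound

variable {n : ℕ} {Hsyn : List ℕ} {piv red : List ℕ} {comb : List (List ℕ)}

/-- In range, `getD` is `getElem`. -/
private theorem getD_eq_getElem {α : Type*} (l : List α) (d : α) {k : ℕ} (hk : k < l.length) :
    l.getD k d = l[k] := by
  rw [List.getD_eq_getElem?_getD, List.getElem?_eq_getElem hk, Option.getD_some]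

/-- Bits of a XOR-fold with an indicator pattern (owner `a`, position `q`). -/
private theorem testBit_xorList_map_indicator (J : List ℕ) (hJ : J.Nodup) (f : ℕ → ℕ) (q a : ℕ)
    (hf : ∀ j ∈ J, (f j).testBit q = decide (j = a)) :
    (xorList (J.map f)).testBit q = decide (a ∈ J) := by
  induction J with
  | nil => simp [xorList]
  | cons x J ih =>
    rw [List.nodup_cons] at hJ
    rw [List.map_cons, xorList, Nat.testBit_xor, ih hJ.2 fun j hj => hf j (List.mem_cons_of_mem _ hj),
      hf x List.mem_cons_self]
    by_cases hxa : x = a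
    · subst hxa; simp [hJ.1]
    · have hax : ¬ a = x := fun e => hxa e.symm
      simp [hxa, hax]

/-- Bits of a XOR-fold vanish where every word's bit vanishes. -/
private theorem testBit_xorList_map_eq_false (J : List ℕ) (f : ℕ → ℕ) (q : ℕ)
    (hf : ∀ j ∈ J, (f j).testBit q = false) : (xorList (J.map f)).testBit q = false := by
  induction J with
  | nil => simp [xorList]
  | cons x J ih =>
    rw [List.map_cons, xorList, Nat.testBit_xor, ih fun j hj => hf j (List.mem_cons_of_mem _ hj),
      hf x List.mem_cons_self]
    rfl

/-- Dot product with a list sum. -/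
private theorem dotProduct_list_sum (v : Fin n → ZMod 2) (L : List (Fin n → ZMod 2)) :
    v ⬝ᵥ L.sum = (L.map fun u => v ⬝ᵥ u).sum := by
  induction L with
  | nil => simp
  | cons u L ih => rw [List.sum_cons, dotProduct_add, ih, List.map_cons, List.sum_cons]

/-- Coordinates of a word. -/
private theorem ofBits_apply' (w : ℕ) (q : Fin n) : ofBits n w q = if w.testBit q then 1 else 0 := rfl

/-- Dot product with the word `2^p`: the `p`-th coordinate. -/
private theorem dotProduct_ofBits_two_pow (v : Fin n → ZMod 2) {p : ℕ} (hp : p < n) :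
    v ⬝ᵥ ofBits n (2 ^ p) = v ⟨p, hp⟩ := by
  rw [ofBits_two_pow n p hp, dotProduct_single, mul_one]

/-- A sum of indicators over a duplicate-free list is the membership indicator. -/
private theorem list_sum_ite_eq (J : List ℕ) (hJ : J.Nodup) (i : ℕ) :
    (J.map fun j => if j = i then (1 : ZMod 2) else 0).sum = if i ∈ J then 1 else 0 := by
  induction J with
  | nil => simp
  | cons x J ih =>
    rw [List.nodup_cons] at hJ
    rw [List.map_cons, List.sum_cons, ih hJ.2]
    by_cases hxi : x = i
    · subst hxi; simp [hJ.1]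
    · have hix : ¬ i = x := fun e => hxi e.symm
      simp [hxi, hix]

/-- The two values of `𝔽₂`. -/
private theorem zmod2_eq_zero_or_one (a : ZMod 2) : a = 0 ∨ a = 1 := by
  revert a; decide

/-- Unpacking `pivotsOK`. -/
theorem pivotsOK_spec (h : pivotsOK n piv red = true) :
    piv.length = red.length ∧ ∀ i, i < piv.length → piv.getD i 0 < n ∧ colMask red (piv.getD i 0) = 2 ^ i := by
  simp only [pivotsOK, Bool.and_eq_true, beq_iff_eq, List.all_eq_true, List.mem_range, decide_eq_true_eq] at h
  exact ⟨h.1, fun i hi => h.2 i hi⟩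

/-- The pivot entries of the reduced rows: `red[i'][piv[i]] = [i' = i]`. -/
theorem testBit_red_piv (h : pivotsOK n piv red = true) {i i' : ℕ} (hi : i < piv.length)
    (hi' : i' < piv.length) : (red.getD i' 0).testBit (piv.getD i 0) = decide (i' = i) := by
  obtain ⟨hlen, hspec⟩ := pivotsOK_spec h
  have hi'r : i' < red.length := hlen ▸ hi'
  have hc := testBit_colMask red (piv.getD i 0) i' hi'r
  rw [(hspec i hi).2, Nat.testBit_two_pow] at hc
  rw [getD_eq_getElem red 0 hi'r, ← hc]
  by_cases e : i' = i
  · subst e; simp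
  · have e' : ¬ i = i' := fun x => e x.symm
    simp [e, e']

/-- The pivots are pairwise distinct. -/
theorem piv_injective (h : pivotsOK n piv red = true) {i i' : ℕ} (hi : i < piv.length) (hi' : i' < piv.length)
    (he : piv.getD i 0 = piv.getD i' 0) : i = i' := by
  have h1 := testBit_red_piv h hi hi      -- red[i][piv i] = true
  have h2 := testBit_red_piv h hi' hi     -- red[i][piv i'] = [i = i']
  rw [he] at h1; rw [h1] at h2; simpa using h2

/-- A value of `piv` (in range) is a member of `piv`. -/
theorem getD_mem_piv {i : ℕ} (hi : i < piv.length) : piv.getD i 0 ∈ piv := by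
  rw [getD_eq_getElem piv 0 hi]; exact List.getElem_mem hi

/-- A free column (not a member of `piv`) differs from every pivot. -/
theorem ne_piv_of_free {q : ℕ} (hq : piv.elem q = false) {i : ℕ} (hi : i < piv.length) : piv.getD i 0 ≠ q := by
  intro he
  have : piv.elem q = true := List.elem_eq_true_of_mem (he ▸ getD_mem_piv hi)
  rw [hq] at this; exact Bool.false_ne_true this

/-- Unpacking `combOK`: each reduced row is the stated XOR of syndrome rows. -/
theorem combOK_spec (h : combOK Hsyn red comb = true) {i : ℕ} (hi : i < red.length) :
    xorRows Hsyn (comb.getD i []) = red.getD i 0 := by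
  simp only [combOK, Bool.and_eq_true, beq_iff_eq, List.all_eq_true, List.mem_range] at h
  exact h.2 i hi

/-- A kernel vector of the syndrome matrix is orthogonal to every reduced row. -/
theorem dotProduct_red_eq_zero (h : combOK Hsyn red comb = true) {w : Fin n → ZMod 2}
    (hw : rowMatrix n Hsyn *ᵥ w = 0) {i : ℕ} (hi : i < red.length) : w ⬝ᵥ ofBits n (red.getD i 0) = 0 := by
  refine dotProduct_eq_zero_of_mem_rowSpace ?_ hw
  rw [← combOK_spec h hi]
  exact ofBits_xorRows_mem_rowSpace n Hsyn _

/-- Membership in `pivSelIdx`. -/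
theorem mem_pivSelIdx_iff {j i : ℕ} : i ∈ pivSelIdx red j ↔ i < red.length ∧ (red.getD i 0).testBit j = true := by
  simp [pivSelIdx, List.mem_filter, List.mem_range]

/-- `pivSelIdx` has no duplicates. -/
theorem nodup_pivSelIdx (j : ℕ) : (pivSelIdx red j).Nodup :=
  List.nodup_range.filter _

/-- Bit `q` of the pivot part of any column, at a FREE column `q`: zero. -/
theorem pivPart_testBit_free (h : pivotsOK n piv red = true) {q : ℕ} (hq : piv.elem q = false) (j : ℕ) :
    (pivPart piv red j).testBit q = false := by
  obtain ⟨hlen, -⟩ := pivotsOK_spec h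
  refine testBit_xorList_map_eq_false _ _ _ fun i hi => ?_
  rw [mem_pivSelIdx_iff] at hi
  rw [Nat.testBit_two_pow]
  exact decide_eq_false (ne_piv_of_free hq (hlen ▸ hi.1))

/-- Bit `piv[i]` of the pivot part of column `j`: `red[i][j]`. -/
theorem pivPart_testBit_piv (h : pivotsOK n piv red = true) {i : ℕ} (hi : i < piv.length) (j : ℕ) :
    (pivPart piv red j).testBit (piv.getD i 0) = (red.getD i 0).testBit j := by
  obtain ⟨hlen, -⟩ := pivotsOK_spec h
  rw [pivPart, testBit_xorList_map_indicator (pivSelIdx red j) (nodup_pivSelIdx j) _ (piv.getD i 0) i]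
  · by_cases hb : (red.getD i 0).testBit j = true
    · rw [hb]; exact decide_eq_true (mem_pivSelIdx_iff.2 ⟨hlen ▸ hi, hb⟩)
    · rw [Bool.not_eq_true] at hb
      rw [hb]; exact decide_eq_false fun hm => by
        have := (mem_pivSelIdx_iff.1 hm).2; rw [hb] at this; exact Bool.false_ne_true this
  · intro i' hi'
    rw [mem_pivSelIdx_iff] at hi'
    rw [Nat.testBit_two_pow]
    by_cases e : i' = i
    · subst e; simp
    · have hne : piv.getD i' 0 ≠ piv.getD i 0 := fun x => e (piv_injective h (hlen ▸ hi'.1) hi x)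
      rw [decide_eq_false hne, decide_eq_false e]

/-- Bit `q` of the kernel-basis word of column `j`, at a FREE column `q`: `[j = q]`. -/
theorem kerVec_testBit_free (h : pivotsOK n piv red = true) {q : ℕ} (hq : piv.elem q = false) (j : ℕ) :
    (kerVec piv red j).testBit q = decide (j = q) := by
  rw [kerVec, Nat.testBit_xor, pivPart_testBit_free h hq, Nat.testBit_two_pow, Bool.xor_false]

/-- The kernel-basis words of free columns are `< 2^n`. -/
theorem kerVec_lt_two_pow (h : pivotsOK n piv red = true) {j : ℕ} (hj : j < n) : kerVec piv red j < 2 ^ n := by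
  obtain ⟨hlen, hspec⟩ := pivotsOK_spec h
  refine Nat.xor_lt_two_pow (Nat.pow_lt_pow_right (by norm_num) hj) (xorList_lt n _ fun x hx => ?_)
  rw [List.mem_map] at hx
  obtain ⟨i, hi, rfl⟩ := hx
  exact Nat.pow_lt_pow_right (by norm_num) (hspec i (hlen ▸ (mem_pivSelIdx_iff.1 hi).1)).1

/-- The reduced row `ρ_i` is orthogonal to the kernel-basis vector of any column `j < n`:
`⟨ρ_i, γ_j⟩ = ρ_i[j] + ρ_i[j] = 0`. -/
theorem dotProduct_red_kerVec (h : pivotsOK n piv red = true) {i : ℕ} (hi : i < piv.length) {j : ℕ} (hjn : j < n) :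
    ofBits n (red.getD i 0) ⬝ᵥ ofBits n (kerVec piv red j) = 0 := by
  obtain ⟨hlen, hspec⟩ := pivotsOK_spec h
  rw [kerVec, ofBits_xor, dotProduct_add, dotProduct_ofBits_two_pow _ hjn, pivPart, ofBits_xorList, List.map_map,
    dotProduct_list_sum, List.map_map]
  -- the second sum: Σ_{i' ∈ sel j} ρ_i[piv i'] = Σ [i' = i] = [i ∈ sel j] = ρ_i[j]
  have hsum : ((pivSelIdx red j).map ((fun u => ofBits n (red.getD i 0) ⬝ᵥ u) ∘ ofBits n ∘ fun i' =>
      2 ^ piv.getD i' 0)).sum = ((pivSelIdx red j).map fun i' => if i' = i then (1 : ZMod 2) else 0).sum := by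
    congr 1
    refine List.map_congr_left fun i' hi' => ?_
    have hi'l : i' < piv.length := hlen ▸ (mem_pivSelIdx_iff.1 hi').1
    simp only [Function.comp_apply]
    rw [dotProduct_ofBits_two_pow _ (hspec i' hi'l).1, ofBits_apply', testBit_red_piv h hi'l hi]
    by_cases e : i' = i
    · subst e; simp
    · have e' : ¬ i = i' := fun x => e x.symm
      rw [if_neg e, decide_eq_false e']
      simp
  rw [hsum, list_sum_ite_eq _ (nodup_pivSelIdx j), ofBits_apply']
  have hval : ((⟨j, hjn⟩ : Fin n) : ℕ) = j := rfl
  rw [hval]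
  by_cases hb : (red.getD i 0).testBit j = true
  · have hm : i ∈ pivSelIdx red j := mem_pivSelIdx_iff.2 ⟨hlen ▸ hi, hb⟩
    rw [if_pos hb, if_pos hm]
    decide
  · have hm : i ∉ pivSelIdx red j := fun hm => hb (mem_pivSelIdx_iff.1 hm).2
    rw [if_neg hb, if_neg hm, add_zero]

/-- For `z` vanishing on the free columns, `⟨ρ_i, z⟩ = z[p_i]`. -/
theorem dotProduct_red_eq_apply_piv (h : pivotsOK n piv red = true) {z : Fin n → ZMod 2}
    (hfree : ∀ q : Fin n, piv.elem (q : ℕ) = false → z q = 0) {i : ℕ} (hi : i < piv.length) :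
    ofBits n (red.getD i 0) ⬝ᵥ z = z ⟨piv.getD i 0, ((pivotsOK_spec h).2 i hi).1⟩ := by
  obtain ⟨hlen, hspec⟩ := pivotsOK_spec h
  rw [dotProduct]
  rw [Finset.sum_eq_single ⟨piv.getD i 0, (hspec i hi).1⟩]
  · rw [ofBits_apply', testBit_red_piv h hi hi]
    simp
  · intro q _ hq
    by_cases hfq : piv.elem (q : ℕ) = false
    · rw [hfree q hfq, mul_zero]
    · -- q is a pivot piv i' with i' ≠ i, so ρ_i[q] = 0
      rw [Bool.not_eq_false] at hfq
      obtain ⟨i', hi', hq'⟩ := List.mem_iff_getElem.1 (List.mem_of_elem_eq_true hfq)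
      have hgetD : piv.getD i' 0 = (q : ℕ) := by rw [getD_eq_getElem piv 0 hi', hq']
      have hne : i' ≠ i := fun e => hq (Fin.ext (by rw [← hgetD, e]))
      rw [ofBits_apply', ← hgetD, testBit_red_piv h hi' hi]
      have : ¬ i = i' := fun e => hne e.symm
      simp [this]
  · intro hq; exact absurd (Finset.mem_univ _) hq

/-- **Uniqueness**: a vector that vanishes on every free column and is orthogonal to every reduced row is `0`. -/
theorem eq_zero_of_free_zero_of_orth (h : pivotsOK n piv red = true) {z : Fin n → ZMod 2}
    (hfree : ∀ q : Fin n, piv.elem (q : ℕ) = false → z q = 0)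
    (horth : ∀ i, i < piv.length → ofBits n (red.getD i 0) ⬝ᵥ z = 0) : z = 0 := by
  funext q
  by_cases hfq : piv.elem (q : ℕ) = false
  · exact hfree q hfq
  · rw [Bool.not_eq_false] at hfq
    obtain ⟨i, hi, hq⟩ := List.mem_iff_getElem.1 (List.mem_of_elem_eq_true hfq)
    have hgetD : piv.getD i 0 = (q : ℕ) := by rw [getD_eq_getElem piv 0 hi, hq]
    have := dotProduct_red_eq_apply_piv h hfree hi
    rw [horth i hi] at this
    have hq' : (⟨piv.getD i 0, ((pivotsOK_spec h).2 i hi).1⟩ : Fin n) = q := Fin.ext hgetD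
    rw [hq'] at this
    exact this.symm

/-- The free support of a vector: the free columns `q < n` with `w q ≠ 0`, increasing. -/
def freeSupp (n : ℕ) (piv : List ℕ) (w : Fin n → ZMod 2) : List ℕ :=
  (suppIdx n w).filter fun j => !(piv.elem j)

/-- The free support has no duplicates. -/
theorem nodup_freeSupp (w : Fin n → ZMod 2) : (freeSupp n piv w).Nodup :=
  (nodup_suppIdx n w).filter _

/-- Membership in the free support. -/
theorem mem_freeSupp_iff (w : Fin n → ZMod 2) (q : Fin n) :
    (q : ℕ) ∈ freeSupp n piv w ↔ w q ≠ 0 ∧ piv.elem (q : ℕ) = false := by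
  rw [freeSupp, List.mem_filter, mem_suppIdx_iff]
  simp

/-- Free-support indices are `< n`. -/
theorem lt_of_mem_freeSupp (w : Fin n → ZMod 2) {j : ℕ} (hj : j ∈ freeSupp n piv w) : j < n :=
  lt_of_mem_suppIdx n w (List.mem_of_mem_filter hj)

/-- Free-support indices are free columns. -/
theorem free_of_mem_freeSupp (w : Fin n → ZMod 2) {j : ℕ} (hj : j ∈ freeSupp n piv w) : piv.elem j = false := by
  have := (List.mem_filter.1 hj).2
  simpa using this

/-- The free support is a sub-list of the free columns, so its image is a sub-list of the kernel basis. -/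
theorem freeSupp_map_sublist_kerBasis (w : Fin n → ZMod 2) :
    ((freeSupp n piv w).map (kerVec piv red)).Sublist (kerBasis n piv red) := by
  refine List.Sublist.map _ ?_
  rw [freeSupp, freeIdx, suppIdx, ← List.map_coe_finRange_eq_range, List.filter_map, List.filter_map]
  exact (List.filter_sublist.filter _).map _

/-- The free support is no longer than the weight. -/
theorem length_freeSupp_le (w : Fin n → ZMod 2) : (freeSupp n piv w).length ≤ hammingNorm w := by
  have := length_suppList n [] w
  rw [suppList, List.length_map] at this
  rw [← this]
  exact List.length_filter_le _ _

/-- **Decomposition**: a kernel vector of the syndrome matrix is the XOR of the kernel-basis words indexed by its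
free support. -/
theorem eq_ofBits_freeSupp (hpiv : pivotsOK n piv red = true) (hcomb : combOK Hsyn red comb = true)
    {w : Fin n → ZMod 2} (hw : rowMatrix n Hsyn *ᵥ w = 0) :
    w = ofBits n (xorList ((freeSupp n piv w).map (kerVec piv red))) := by
  obtain ⟨hlen, hspec⟩ := pivotsOK_spec hpiv
  set u := ofBits n (xorList ((freeSupp n piv w).map (kerVec piv red))) with hu
  -- z := w + u vanishes on free columns and is orthogonal to the reduced rows
  have hz : w + u = 0 := by
    refine eq_zero_of_free_zero_of_orth hpiv (fun q hq => ?_) (fun i hi => ?_)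
    · -- free coordinate: u q = [q ∈ freeSupp] = w q
      have huq : u q = if (q : ℕ) ∈ freeSupp n piv w then 1 else 0 := by
        rw [hu, ofBits_apply', testBit_xorList_map_indicator (freeSupp n piv w) (nodup_freeSupp w)
          (kerVec piv red) q q fun j hj => kerVec_testBit_free hpiv hq j]
        by_cases hm : (q : ℕ) ∈ freeSupp n piv w <;> simp [hm]
      rw [Pi.add_apply, huq]
      by_cases hm : (q : ℕ) ∈ freeSupp n piv w
      · have hwq : w q ≠ 0 := ((mem_freeSupp_iff w q).1 hm).1
        rcases zmod2_eq_zero_or_one (w q) with h0 | h1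
        · exact absurd h0 hwq
        · rw [h1, if_pos hm]; decide
      · have hwq : w q = 0 := by
          by_contra hne
          exact hm ((mem_freeSupp_iff w q).2 ⟨hne, hq⟩)
        rw [hwq, if_neg hm, add_zero]
    · -- orthogonality: ⟨ρ_i, w⟩ = 0 (row space) and ⟨ρ_i, u⟩ = Σ ⟨ρ_i, γ_j⟩ = 0
      rw [dotProduct_add, dotProduct_comm, dotProduct_red_eq_zero hcomb hw (hlen ▸ hi), zero_add, hu,
        ofBits_xorList, List.map_map, dotProduct_list_sum, List.map_map]
      refine List.sum_eq_zero fun x hx => ?_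
      rw [List.mem_map] at hx
      obtain ⟨j, hj, rfl⟩ := hx
      exact dotProduct_red_kerVec hpiv hi (lt_of_mem_freeSupp w hj)
  -- in characteristic 2, w + u = 0 gives w = u
  funext q
  have := congrFun hz q
  rw [Pi.add_apply, Pi.zero_apply] at this
  rcases zmod2_eq_zero_or_one (w q) with h0 | h1 <;> rcases zmod2_eq_zero_or_one (u q) with h0' | h1' <;>
    simp_all

/-- **Soundness of the information-set lower bound.** If the RREF certificate checks and every XOR of between `1`
and `b + 1` kernel-basis words passes a `test` guaranteeing at least `b + 2` set bits below `n`, then every nonzero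
kernel vector of the syndrome matrix has Hamming weight `≥ b + 2`. -/
theorem infoSet_lower_sound (hpiv : pivotsOK n piv red = true) (hcomb : combOK Hsyn red comb = true)
    {test : ℕ → Bool} {b : ℕ} (htest : ∀ x, test x = true → x < 2 ^ n → b + 2 ≤ popc n x)
    (hreach : DReaches test (kerBasis n piv red) b 0) (w : Fin n → ZMod 2) (hw : rowMatrix n Hsyn *ᵥ w = 0)
    (hw0 : w ≠ 0) : b + 2 ≤ hammingNorm w := by
  by_contra hlt
  rw [not_le] at hlt
  set S := (freeSupp n piv w).map (kerVec piv red) with hS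
  have hdec := eq_ofBits_freeSupp hpiv hcomb hw
  have hSne : S ≠ [] := by
    intro he
    rw [← hS, he, xorList, ofBits_zero] at hdec
    exact hw0 hdec
  have hlenS : S.length ≤ b + 1 := by
    rw [hS, List.length_map]
    have := length_freeSupp_le (piv := piv) w
    omega
  rw [← hS] at hdec
  have ht := hreach S (freeSupp_map_sublist_kerBasis w) hSne hlenS
  rw [Nat.zero_xor] at ht
  have hSlt : xorList S < 2 ^ n := by
    refine xorList_lt n S fun x hx => ?_
    rw [hS, List.mem_map] at hx
    obtain ⟨j, hj, rfl⟩ := hx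
    exact kerVec_lt_two_pow hpiv (lt_of_mem_freeSupp w hj)
  have hge := htest _ ht hSlt
  rw [← hammingNorm_ofBits, ← hdec] at hge
  omega

end Sound

namespace DistCert

variable (c : DistCert)

/-- **`d_Z` from an information-set certificate** (tier = the tier of the replay): the structural check of the
distance certificate (upper witnesses), the RREF certificate of `H_X` and a passing short-XOR replay over its kernel
basis with a test guaranteeing `≥ c.dZ` set bits give `d_Z = c.dZ` for the code `c.code`. -/
theorem dZ_code_of_infoSet (hs : c.checkStructure = true) (ic : InfoSetCert)
    (hI : infoSetStructOK c.n c.HX ic = true) {test : ℕ → Bool}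
    (htest : ∀ x, test x = true → x < 2 ^ c.n → c.dZ ≤ popc c.n x)
    (hreach : DReaches test (kerBasis c.n ic.piv ic.red) (c.dZ - 2) 0) (hd : 2 ≤ c.dZ) :
    (c.code (c.commOK_of_checkStructure hs)).dZ = c.dZ := by
  have h' := hs
  simp only [checkStructure, Bool.and_eq_true] at h'
  simp only [infoSetStructOK, Bool.and_eq_true] at hI
  obtain ⟨hv, hv', hwt⟩ := upper_sound h'.1.1.1.2
  refine (c.code _).dZ_eq_of_witness hv hv' hwt fun w hw hw' => ?_
  have hw0 : w ≠ 0 := fun h0 => hw' (h0 ▸ Submodule.zero_mem _)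
  have := infoSet_lower_sound (b := c.dZ - 2) hI.1 hI.2 (fun x hx hxn => by have := htest x hx hxn; omega)
    hreach w hw hw0
  omega

/-- **`d_X` from an information-set certificate** (roles of `H_X`, `H_Z` exchanged). -/
theorem dX_code_of_infoSet (hs : c.checkStructure = true) (ic : InfoSetCert)
    (hI : infoSetStructOK c.n c.HZ ic = true) {test : ℕ → Bool}
    (htest : ∀ x, test x = true → x < 2 ^ c.n → c.dX ≤ popc c.n x)
    (hreach : DReaches test (kerBasis c.n ic.piv ic.red) (c.dX - 2) 0) (hd : 2 ≤ c.dX) :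
    (c.code (c.commOK_of_checkStructure hs)).dX = c.dX := by
  have h' := hs
  simp only [checkStructure, Bool.and_eq_true] at h'
  simp only [infoSetStructOK, Bool.and_eq_true] at hI
  obtain ⟨hv, hv', hwt⟩ := upper_sound h'.1.2
  refine (c.code _).dX_eq_of_witness hv hv' hwt fun w hw hw' => ?_
  have hw0 : w ≠ 0 := fun h0 => hw' (h0 ▸ Submodule.zero_mem _)
  have := infoSet_lower_sound (b := c.dX - 2) hI.1 hI.2 (fun x hx hxn => by have := htest x hx hxn; omega)
    hreach w hw hw0
  omega

end DistCert

end Summit.Ventures.QEC.Census
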